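import Literature.NumberTheory.EllipticCurves.RohrlichAnticyclotomicRootNumber
import Literature.NumberTheory.EllipticCurves.CMNewformOfHeckeCharacter
import HarnessLib

/-!
# The anticyclotomic twists `χ = φρ ∈ X` are Hecke characters of infinity type `(1, 0)`, hence
# correspond to CM newforms of weight `2` (Hecke–Shimura; Jia 2026 §1) — proved bookkeeping

Topic `Literature/NumberTheory/EllipticCurves`; companion of `RohrlichAnticyclotomicNonvanishing.lean`
and `RohrlichAnticyclotomicRootNumber.lean` (cell `bsd-goldfeld`, typer seat `bsd-goldfeld-ty` g3).
THEOREMS ONLY: no named fact, no definition, no instance, no notation.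

Jia, Acta Arith. 2026, §1 (held `paper:arxiv-2412.05867`, chunk p0003), on the members `χ = φρ` of
Rohrlich's family `X`: "We know that there is a cusp form of weight 2, which has trivial central
character in our case, associated with `χ` (see [Hecke], [Shi71], [Shi72]). Then there is an abelian
variety `A` associated to this cusp form … of GL₂-type, and has complex multiplication over `K`";
Li–Xu, JNT 293 (2027) §1: "By the work of Hecke and Shimura, one can attach a modular form `θ_φ`
to `φ`. Furthermore … an abelian variety `A_φ` over `ℚ`". In the tree the Hecke–Shimura step is the
named fact `ModularForms.Ribet1977_cmNewform_of_heckeCharacter` (`CMNewformOfHeckeCharacter.lean`: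
a Hecke character of an imaginary quadratic field of infinity type `(k−1, 0)` has a weight-`k`
newform with the induced Hecke polynomials). This file supplies the (elementary) missing link and
the composite:

* `hasInfinityType_zero_of_isFiniteOrder` — a finite-order Hecke character has trivial infinity
  type `(0, 0)` (its restriction to `(K ⊗ ℝ)ˣ` is continuous with values in the `n`-th roots of
  unity, hence `1` near `1`; same argument as the tree's `HeckeCharacter.IsFiniteOrder.isAlgebraic`,
  which records only the existence of SOME type);
* `hasInfinityType_oneZero_mul_of_mem_anticyclotomicTwistFamily` — for `ρ ∈ X_P` and `φ` of type
  `(1, 0)`, the twist `φρ` has type `(1, 0)` (so EVERY hypothesis placed on `φ` in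
  `RohrlichJia_centralOrder_anticyclotomicTwists` / `hecke_centralRootNumber_anticyclotomicTwists` is
  inherited by each member of `X`: type `(1,0)` here, equivariance in
  `IsHeckeConjEquivariant.mul_of_mem_anticyclotomicTwistFamily`);
* `not_isTotallyReal_of_isImaginaryQuadratic` — bookkeeping between the two "imaginary quadratic"
  spellings of the tree (`IsImaginaryQuadratic`, and Ribet's `finrank = 2 ∧ ¬ IsTotallyReal`);
* `exists_cmNewform_of_mem_anticyclotomicTwistFamily` — **granted Ribet's fact, every `χ = φρ ∈ X`
  has a weight-2 newform `f_χ` on some `Γ₁(N)` whose Hecke polynomial at every `p ∤ N` is induced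
  from `χ`** (`a_p = χ(𝔭) + χ(𝔭̄)` at split `p`, `a_p = 0` at inert `p`): the "cusp form of weight 2
  associated with `χ`" of Jia §1 / the `θ_φ` of Li–Xu, in the tree's currency.

References: [Jia2026ActaArith] §1; [LiXu2025JNT] §1; [Ribet1977Nebentypus] §3 Thm. (3.4), Cor. (3.5)
(through the tree fact); Neukirch, *Algebraic Number Theory* VII (6.9) (finite-order characters have
trivial infinity type) [NeukirchANT1999].
-/

noncomputable section

open scoped ComplexConjugate Polynomial
open NumberField IsDedekindDomain Polynomial
open Literature.NumberTheory.Automorphic Literature.NumberTheory.GaloisRepresentations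
open Literature.NumberTheory.EllipticCurves.ModularForms

namespace Literature.NumberTheory.EllipticCurves

variable {K : Type} [Field K] [NumberField K]

/-- The inclusion of the infinite ideles `(K ⊗ ℝ)ˣ → 𝕀_K`, `x ↦ (x, 1)`, is continuous (private copy
of `HeckeCharacter.continuous_infiniteIdeles`, whose file is not imported here). [folklore] -/
private theorem continuous_infiniteIdeles'' : Continuous (infiniteIdeles K) :=
  Continuous.units_map _ (continuous_id.prodMk continuous_const)

/-- **A finite-order Hecke character has infinity type `(0, 0)`**: if `ρⁿ = 1` then
`x ↦ ρ((x, 1))` is continuous on `(K ⊗ ℝ)ˣ` with values in the `n`-th roots of unity, so it equals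
`1 = A_{0,0}(x)` on the open neighbourhood of `1` where it avoids the finitely many roots of unity
`≠ 1` (Neukirch VII (6.9): characters of finite order have trivial infinity type; the tree's
`HeckeCharacter.IsFiniteOrder.isAlgebraic` is the same argument recording only `∃ (p, q)`).
[cite: NeukirchANT1999, Ch. VII (6.9)] -/
theorem hasInfinityType_zero_of_isFiniteOrder {ρ : HeckeCharacter K} (hρ : ρ.IsFiniteOrder) :
    ρ.HasInfinityType (fun _ ↦ 0) (fun _ ↦ 0) := by
  obtain ⟨n, hn, h1⟩ := hρ.exists_pow_eq_one
  set f : (InfiniteAdeleRing K)ˣ → ℂ := fun x ↦ (ρ (infiniteIdeles K x) : ℂ) with hf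
  have hcont : Continuous f :=
    Units.continuous_val.comp ((map_continuous ρ).comp continuous_infiniteIdeles'')
  have hpow : ∀ x, f x ^ n = 1 := fun x ↦ by
    have h := congrArg (fun χ : HeckeCharacter K ↦ ((χ (infiniteIdeles K x) : ℂˣ) : ℂ)) h1
    simpa [HeckeCharacter.pow_apply, Units.val_pow_eq_pow_val] using h
  set S : Set ℂ := {z | z ^ n = 1 ∧ z ≠ 1} with hS
  have hSfin : S.Finite := by
    refine (Multiset.finite_toSet (Polynomial.nthRoots n (1 : ℂ))).subset fun z hz ↦ ?_
    simp only [Set.mem_setOf_eq] at hz ⊢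
    exact (Polynomial.mem_nthRoots hn).mpr hz.1
  have hopen : IsOpen (f ⁻¹' Sᶜ) := hSfin.isClosed.isOpen_compl.preimage hcont
  have hone : (1 : (InfiniteAdeleRing K)ˣ) ∈ f ⁻¹' Sᶜ := by
    simp [hf, hS]
  refine ⟨f ⁻¹' Sᶜ, hopen.mem_nhds hone, fun x hx ↦ ?_⟩
  have hx' : f x ∉ S := hx
  have hfx : f x = 1 := by
    by_contra hne
    exact hx' ⟨hpow x, hne⟩
  rw [HeckeCharacter.archFactor_apply]
  simp only [neg_zero, zpow_zero, mul_one, Finset.prod_const_one]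
  exact hfx

/-- **Members of `X` have infinity type `(1, 0)`**: for `φ` of type `(1, 0)` and `ρ` in the family
`anticyclotomicTwistFamily c P` (finite order), `φρ` has type `(1, 0)` (Jia 2026 §1: `χ = φρ` "also
has infinite type (1,0)"). [cite: Jia2026ActaArith, §1 (the set X)] -/
theorem hasInfinityType_oneZero_mul_of_mem_anticyclotomicTwistFamily {c : K ≃ₐ[ℚ] K}
    {φ ρ : HeckeCharacter K} (hφ : φ.HasInfinityType (fun _ ↦ 1) (fun _ ↦ 0)) {P : Finset ℕ}
    (hρ : ρ ∈ anticyclotomicTwistFamily c P) :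
    (φ * ρ).HasInfinityType (fun _ ↦ 1) (fun _ ↦ 0) := by
  have h := hφ.mul' (hasInfinityType_zero_of_isFiniteOrder hρ.1)
  simp only [Pi.add_def, add_zero] at h
  exact h

/-- An imaginary quadratic field (`IsImaginaryQuadratic`: degree `2`, totally complex) is not totally
real — the spelling `¬ IsTotallyReal K` used by `Ribet1977_cmNewform_of_heckeCharacter`. [folklore] -/
private theorem not_isTotallyReal_of_isImaginaryQuadratic (hK : IsImaginaryQuadratic K) :
    ¬ IsTotallyReal K := by
  intro hR
  obtain ⟨w⟩ := (inferInstance : Nonempty (InfinitePlace K))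
  have hc : w.IsComplex := hK.2.isComplex w
  exact (InfinitePlace.not_isReal_iff_isComplex.mpr hc) (hR.isReal w)

/-- **Every `χ = φρ ∈ X` is attached to a CM newform of weight `2`** (Jia 2026 §1: "there is a cusp
form of weight 2 … associated with `χ` (see [Hecke], [Shi71], [Shi72])"; Li–Xu §1: "`θ_φ`"). GRANTED
the tree's named fact `Ribet1977_cmNewform_of_heckeCharacter` (Hecke–Shimura–Ribet, LNM 601 §3), for
`K` imaginary quadratic, `φ` of infinity type `(1, 0)` and `ρ ∈ anticyclotomicTwistFamily c P`: there
are a level `N` and a newform `f ∈ S₂(Γ₁(N))` such that at every prime `p ∤ N`, `p` is unramified in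
`K`, `φρ` is unramified above `p`, and the Hecke polynomial `X² − a_p(f)X + ε(p)p` of `f` equals
`∏_{w ∣ p}(X^{f(w|p)} − (φρ)(ϖ_w))` (`a_p = χ(𝔭) + χ(𝔭̄)` at split `p`, `a_p = 0` at inert `p`).
[cite: Jia2026ActaArith, §1] [cite: Ribet1977Nebentypus, §3 Thm. (3.4) and Cor. (3.5)] -/
theorem exists_cmNewform_of_mem_anticyclotomicTwistFamily
    (hRib : Ribet1977_cmNewform_of_heckeCharacter) (hK : IsImaginaryQuadratic K)
    {c : K ≃ₐ[ℚ] K} {φ ρ : HeckeCharacter K} (hφ : φ.HasInfinityType (fun _ ↦ 1) (fun _ ↦ 0))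
    {P : Finset ℕ} (hρ : ρ ∈ anticyclotomicTwistFamily c P) :
    ∃ (N : ℕ) (_ : NeZero N) (f : CuspForm (CongruenceSubgroup.Gamma1 N) ((2 : ℕ) : ℤ)),
      IsNewform1 f ∧
      ∀ v : HeightOneSpectrum (𝓞 ℚ),
        ¬ ((Rat.HeightOneSpectrum.primesEquiv v : Nat.Primes) : ℕ) ∣ N →
        v.asIdeal.ramificationIdxIn (𝓞 K) = 1 ∧
        (∀ w : HeightOneSpectrum (𝓞 K), w.asIdeal.under (𝓞 ℚ) = v.asIdeal →
          (φ * ρ).IsUnramifiedAt w) ∧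
        (heckePolynomial f (Rat.HeightOneSpectrum.primesEquiv v : Nat.Primes)).map
            (algebraMap (coeffCharField f) ℂ) =
          inducedFrobPolynomial v (fun w ↦ X - C ((φ * ρ).valueAtUniformizer w)) := by
  have hχ := hasInfinityType_oneZero_mul_of_mem_anticyclotomicTwistFamily hφ hρ
  have hχ' : (φ * ρ).HasInfinityType (fun _ ↦ ((2 : ℕ) : ℤ) - 1) (fun _ ↦ 0) := by
    have h21 : (fun _ : InfinitePlace K ↦ ((2 : ℕ) : ℤ) - 1) = fun _ ↦ (1 : ℤ) := by
      funext; norm_num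
    rw [h21]
    exact hχ
  exact hRib K hK.1 (not_isTotallyReal_of_isImaginaryQuadratic hK) 2 le_rfl (φ * ρ) (Or.inl hχ')

end Literature.NumberTheory.EllipticCurves
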